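import Mathlib
import HarnessLib
import Literature.MathematicalPhysics.QuantumFieldTheory.Federbush1986.LatticeActionFiniteAction
import Literature.Analysis.FunctionSpaces.BesselIGeneratingFunction
import Summits.Ventures.LatticeQCDFlow.Scaling.U1IdentityFlowVolumeLaw

/-!
# LatticeQCDFlow / Scaling — the WEAK-COUPLING LIMIT of the untrained sampler: as `β → ∞`,
# `Z(β/2)²/Z(β) → μ{T = max T}` and `Z(β)²/Z(2β) → μ{T = max T}` for every tilt family; for U(1)
# plaquettes the limit is `0`, so `I₀(β/2)²/I₀(β) → 0`, `I₀(β)²/I₀(2β) → 0` and the untrained U(1)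
# sampler's ESS and acceptance tend to `0` in every volume

HONEST FRAMING: exact (Metropolis-corrected) sampling algorithms for lattice gauge theory;
figures of merit are autocorrelation/cost numbers at stated couplings and volumes; no
continuum-physics claim.

Venture `LatticeQCDFlow` (cell pub-lqcd), topic `Scaling`; FANOUT row 3 (`s0-u1-a`, S0-B
implementation A, GEN-16).  NEW WORK of the cell (elementary measure theory), not a published result;
NO definition is introduced.  Row 3's identity-flow laws pin the untrained exact sampler of a tilt
`e^{βT}μ/Z(β)` (`μ` a finite reference law, `Z(β) = ∫ e^{βT} dμ`) between `(8/9)·Z(β)²/(Z(2β)Z(0))`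
and the Bhattacharyya ceiling `Z(β/2)²/(Z(β)Z(0))` (`Scaling/WilsonIdentityFlowLaw`,
`U1IdentityFlowVolumeLaw`); `Scaling/IdentityFlowCouplingMonotone` (GEN-16) shows both ratios are
non-increasing in `β ≥ 0`.  This file computes their LIMIT.  With `M` an essential maximum of `T`
(`T ≤ M`, and `μ{T > M − ε} > 0` for every `ε > 0`) and `Φ(β) = ∫ e^{β(T−M)} dμ = Z(β)e^{−βM}`:

* §1 `tendsto_integral_exp_mul_sub` — `Φ(β) → μ{T = M}` (dominated convergence);
  **`tendsto_sq_integral_exp_half_div`** — `Φ(β/2)²/Φ(β) → μ{T = M}` (a quotient of limits if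
  `μ{T = M} > 0`; else a Cauchy–Schwarz split at the level `M − ε`: `Φ(β/2)² ≤ 2μ{T > M−ε}Φ(β) +
  2e^{−βε}μ(Ω)²`, `Φ(β) ≥ e^{−βε/2}μ{T > M−ε/2}`, and `μ{T > M−ε} ↓ 0`); in `Z = mgf T μ` form
  **`tendsto_mgf_half_sq_div`** and **`tendsto_mgf_sq_div_double`** (`Z(β)²/Z(2β)`, same limit);
* §2 U(1) PLAQUETTES (`T = cos` on `(0, 2π]`, `M = 1`, `{cos = 1} = {2π}` is Lebesgue-null):
  **`tendsto_besselI_half_sq_div_atTop`** `I₀(β/2)²/I₀(β) → 0`, **`tendsto_besselI_sq_div_double_atTop`**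
  `I₀(β)²/I₀(2β) → 0`, and for every `V ≥ 1` plaquettes
  **`u1IdentityFlow_essFrac_weakCoupling_tendsto_zero`** (the exact ESS `(I₀(β)²/I₀(2β))^V` of
  row 3's untrained U(1) sampler tends to `0`) and
  **`u1IdentityFlow_meanAccept_weakCoupling_tendsto_zero`** (so does its acceptance).

Reading (value-free; no number of ours is computed or implied): at weak coupling the untrained
exact sampler of a tilt family survives exactly to the extent that the maximisers of `T` carry
reference mass; for U(1) plaquettes that mass is zero, so the Bhattacharyya ceiling, the ESS and the
acceptance of row 3's untrained U(1) sampler all vanish as `β → ∞` in every volume (Wilson form: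
the sequel `Scaling/WilsonIdentityFlowWeakCouplingLimit`).  NOT CLAIMED: the rate of the decay
(`β^{−1/2}` per plaquette, classical, not typed); any value at the cell's `(β, L)`; SEALED.md untouched.
-/

noncomputable section

namespace Summit.Ventures.LatticeQCDFlow.Theory2

open MeasureTheory Real Set Filter Topology ProbabilityTheory
open Literature.Analysis.FunctionSpaces (besselI besselI_zero_pos)
open Summit.Ventures.LatticeQCDFlow.Scoring (onePlaquetteZ onePlaquetteZ_pos onePlaquetteZ_eq_besselI)

/-! ## §1 The weak-coupling limit of a tilt family -/

section Tilt

variable {Ω : Type*} [MeasurableSpace Ω] {μ : Measure Ω} [IsFiniteMeasure μ] {T : Ω → ℝ} {M : ℝ}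

/-- `e^{t(T−M)}` is integrable for `t ≥ 0` when `T ≤ M` (it lies in `[0, 1]`). [folklore] -/
theorem integrable_exp_mul_sub_of_le (hT : Measurable T) (hle : ∀ ω, T ω ≤ M) {t : ℝ}
    (ht : 0 ≤ t) : Integrable (fun ω => Real.exp (t * (T ω - M))) μ := by
  refine Integrable.of_mem_Icc 0 1
    (Real.measurable_exp.comp ((hT.sub_const M).const_mul t)).aemeasurable
    (ae_of_all _ fun ω => ⟨(Real.exp_pos _).le, ?_⟩)
  exact Real.exp_le_one_iff.2 (mul_nonpos_of_nonneg_of_nonpos ht (sub_nonpos.2 (hle ω)))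

/-- **`Φ(t) = ∫ e^{t(T−M)} dμ → μ{T = M}` as `t → ∞`** (dominated convergence: the integrand
decreases to the indicator of `{T = M}`). [ours] -/
theorem tendsto_integral_exp_mul_sub (hT : Measurable T) (hle : ∀ ω, T ω ≤ M) :
    Tendsto (fun t : ℝ => ∫ ω, Real.exp (t * (T ω - M)) ∂μ) atTop
      (𝓝 (μ.real {ω | T ω = M})) := by
  have hS : MeasurableSet {ω | T ω = M} := hT (measurableSet_singleton M)
  rw [← integral_indicator_one hS]
  refine tendsto_integral_filter_of_dominated_convergence (fun _ => (1 : ℝ)) ?_ ?_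
    (integrable_const _) ?_
  · exact Eventually.of_forall fun t =>
      (Real.measurable_exp.comp ((hT.sub_const M).const_mul t)).aestronglyMeasurable
  · filter_upwards [eventually_ge_atTop (0 : ℝ)] with t ht
    refine ae_of_all _ fun ω => ?_
    rw [Real.norm_eq_abs, abs_of_pos (Real.exp_pos _)]
    exact Real.exp_le_one_iff.2 (mul_nonpos_of_nonneg_of_nonpos ht (sub_nonpos.2 (hle ω)))
  · refine ae_of_all _ fun ω => ?_
    by_cases hω : T ω = M
    · have hmem : ω ∈ {ω | T ω = M} := hω
      simp only [Set.indicator_of_mem hmem, Pi.one_apply, hω, sub_self, mul_zero, Real.exp_zero]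
      exact tendsto_const_nhds
    · have hmem : ω ∉ {ω | T ω = M} := hω
      simp only [Set.indicator_of_notMem hmem]
      have hc : 0 < M - T ω := sub_pos.2 (lt_of_le_of_ne (hle ω) hω)
      have e : (fun t : ℝ => Real.exp (t * (T ω - M))) = fun t => Real.exp (-(t * (M - T ω))) := by
        funext t; congr 1; ring
      rw [e]
      exact Real.tendsto_exp_neg_atTop_nhds_zero.comp (tendsto_id.atTop_mul_const hc)

/-- **THE WEAK-COUPLING LIMIT `Φ(t/2)²/Φ(t) → μ{T = M}`** for `Φ(t) = ∫ e^{t(T−M)} dμ`, `T ≤ M` an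
essential maximum (`μ{T > M − ε} > 0` for all `ε > 0`), `μ` finite and non-zero. [ours] -/
theorem tendsto_sq_integral_exp_half_div [NeZero μ] (hT : Measurable T) (hle : ∀ ω, T ω ≤ M)
    (hsharp : ∀ ε : ℝ, 0 < ε → 0 < μ {ω | M - ε < T ω}) :
    Tendsto (fun t : ℝ => (∫ ω, Real.exp (t / 2 * (T ω - M)) ∂μ) ^ 2
        / ∫ ω, Real.exp (t * (T ω - M)) ∂μ) atTop (𝓝 (μ.real {ω | T ω = M})) := by
  set Φ : ℝ → ℝ := fun t => ∫ ω, Real.exp (t * (T ω - M)) ∂μ with hΦ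
  show Tendsto (fun t => Φ (t / 2) ^ 2 / Φ t) atTop _
  have hint : ∀ t : ℝ, 0 ≤ t → Integrable (fun ω => Real.exp (t * (T ω - M))) μ :=
    fun t ht => integrable_exp_mul_sub_of_le hT hle ht
  have hΦnn : ∀ t, 0 ≤ Φ t := fun t => integral_nonneg fun ω => (Real.exp_pos _).le
  have hlim : Tendsto Φ atTop (𝓝 (μ.real {ω | T ω = M})) := tendsto_integral_exp_mul_sub hT hle
  have hlim2 : Tendsto (fun t => Φ (t / 2)) atTop (𝓝 (μ.real {ω | T ω = M})) :=
    hlim.comp (tendsto_id.atTop_div_const two_pos)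
  by_cases hm : μ.real {ω | T ω = M} = 0
  swap
  · -- positive mass at the maximum: a quotient of limits
    have key := (hlim2.pow 2).div hlim hm
    rwa [sq, mul_div_assoc, div_self hm, mul_one] at key
  -- no mass at the maximum: the ratio tends to `0`
  rw [hm]
  refine tendsto_order.2 ⟨fun a ha => Eventually.of_forall fun t =>
    lt_of_lt_of_le ha (div_nonneg (sq_nonneg _) (hΦnn t)), fun δ hδ => ?_⟩
  -- Step A: choose `ε` with `μ{T > M − ε} ≤ δ/8` (continuity from above down to `{T = M}`, null)
  have hmeasn : ∀ n : ℕ, MeasurableSet {ω | M - 1 / ((n : ℝ) + 1) < T ω} :=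
    fun n => measurableSet_lt measurable_const hT
  have hanti : Antitone fun n : ℕ => {ω | M - 1 / ((n : ℝ) + 1) < T ω} := by
    intro m n hmn ω hω
    have hω' : M - 1 / ((n : ℝ) + 1) < T ω := hω
    have h1 : 1 / ((n : ℝ) + 1) ≤ 1 / ((m : ℝ) + 1) :=
      one_div_le_one_div_of_le (by positivity) (by exact_mod_cast Nat.succ_le_succ hmn)
    show M - 1 / ((m : ℝ) + 1) < T ω
    linarith
  have hInter : (⋂ n : ℕ, {ω | M - 1 / ((n : ℝ) + 1) < T ω}) = {ω | T ω = M} := by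
    ext ω
    simp only [Set.mem_iInter, Set.mem_setOf_eq]
    constructor
    · intro h
      refine le_antisymm (hle ω) (le_of_not_gt fun hlt => ?_)
      obtain ⟨n, hn⟩ := exists_nat_one_div_lt (sub_pos.2 hlt)
      have := h n
      linarith
    · intro h n
      have : (0 : ℝ) < 1 / ((n : ℝ) + 1) := by positivity
      linarith
  have hcont : Tendsto (fun n : ℕ => μ {ω | M - 1 / ((n : ℝ) + 1) < T ω}) atTop (𝓝 0) := by
    have h := tendsto_measure_iInter_atTop (μ := μ) (fun n => (hmeasn n).nullMeasurableSet) hanti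
      ⟨0, measure_ne_top μ _⟩
    rw [hInter, (measureReal_eq_zero_iff (measure_ne_top μ _)).1 hm] at h
    exact h
  obtain ⟨n, hn⟩ := (ENNReal.tendsto_atTop_zero.1 hcont) (ENNReal.ofReal (δ / 8))
    (ENNReal.ofReal_pos.2 (by positivity))
  set ε : ℝ := 1 / ((n : ℝ) + 1) with hε
  have hε0 : 0 < ε := by positivity
  set S : Set Ω := {ω | M - ε < T ω} with hSdef
  have hSm : MeasurableSet S := measurableSet_lt measurable_const hT
  have hSδ : μ.real S ≤ δ / 8 := ENNReal.toReal_le_of_le_ofReal (by positivity) (hn n le_rfl)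
  -- Step B: the floor `Φ(t) ≥ e^{−tε/2} μ{T > M − ε/2}` for `t ≥ 0`
  set S' : Set Ω := {ω | M - ε / 2 < T ω} with hS'def
  have hS'm : MeasurableSet S' := measurableSet_lt measurable_const hT
  have hS'pos : 0 < μ.real S' :=
    ENNReal.toReal_pos (hsharp (ε / 2) (half_pos hε0)).ne' (measure_ne_top μ _)
  have hlow : ∀ t : ℝ, 0 ≤ t → Real.exp (-(t * (ε / 2))) * μ.real S' ≤ Φ t := by
    intro t ht
    have h1 : ∫ ω, S'.indicator (fun _ => Real.exp (-(t * (ε / 2)))) ω ∂μ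
        = Real.exp (-(t * (ε / 2))) * μ.real S' := by
      rw [integral_indicator_const _ hS'm, smul_eq_mul, mul_comm]
    rw [← h1]
    refine integral_mono ((integrable_const _).indicator hS'm) (hint t ht) fun ω => ?_
    by_cases hω : ω ∈ S'
    · rw [Set.indicator_of_mem hω]
      have hω' : M - ε / 2 < T ω := hω
      exact Real.exp_le_exp.2 (by nlinarith)
    · rw [Set.indicator_of_notMem hω]
      exact (Real.exp_pos _).le
  -- Step C: the Cauchy–Schwarz split `Φ(t/2)² ≤ 2 μ(S) Φ(t) + 2 (e^{−tε/2} μ(Ω))²` for `t ≥ 0`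
  have hup : ∀ t : ℝ, 0 ≤ t → Φ (t / 2) ^ 2
      ≤ 2 * μ.real S * Φ t + 2 * (Real.exp (-(t * (ε / 2))) * μ.real univ) ^ 2 := by
    intro t ht
    have hg_int : Integrable (fun ω => Real.exp (t / 2 * (T ω - M))) μ := hint (t / 2) (by positivity)
    have hg2 : ∀ ω, Real.exp (t / 2 * (T ω - M)) ^ 2 = Real.exp (t * (T ω - M)) := by
      intro ω; rw [sq, ← Real.exp_add]; ring_nf
    have hg2_int : Integrable (fun ω => Real.exp (t / 2 * (T ω - M)) ^ 2) μ := by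
      simp_rw [hg2]; exact hint t ht
    have hsplit : Φ (t / 2) = ∫ ω in S, Real.exp (t / 2 * (T ω - M)) ∂μ
        + ∫ ω in Sᶜ, Real.exp (t / 2 * (T ω - M)) ∂μ := (integral_add_compl hSm hg_int).symm
    -- Cauchy–Schwarz on `S`
    have hA : (∫ ω in S, Real.exp (t / 2 * (T ω - M)) ∂μ) ^ 2 ≤ μ.real S * Φ t := by
      have hcs := Literature.MathematicalPhysics.QuantumFieldTheory.Federbush1986.sq_integral_le_measureReal_mul_integral_sq
        (μ := μ.restrict S) hg_int.restrict hg2_int.restrict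
      rw [measureReal_restrict_apply_univ] at hcs
      refine hcs.trans (mul_le_mul_of_nonneg_left ?_ measureReal_nonneg)
      calc ∫ ω in S, Real.exp (t / 2 * (T ω - M)) ^ 2 ∂μ
          ≤ ∫ ω, Real.exp (t / 2 * (T ω - M)) ^ 2 ∂μ :=
            setIntegral_le_integral hg2_int (ae_of_all _ fun ω => sq_nonneg _)
        _ = Φ t := integral_congr_ae (ae_of_all _ hg2)
    -- the tail below the level `M − ε`
    have hB : ∫ ω in Sᶜ, Real.exp (t / 2 * (T ω - M)) ∂μ
        ≤ Real.exp (-(t * (ε / 2))) * μ.real univ := by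
      have h1 : ∫ ω in Sᶜ, Real.exp (t / 2 * (T ω - M)) ∂μ ≤ ∫ ω in Sᶜ, Real.exp (-(t * (ε / 2))) ∂μ := by
        refine setIntegral_mono_on hg_int.integrableOn (integrableOn_const) hSm.compl fun ω hω => ?_
        have hω' : T ω ≤ M - ε := not_lt.1 hω
        exact Real.exp_le_exp.2 (by nlinarith)
      rw [setIntegral_const, smul_eq_mul] at h1
      refine h1.trans ?_
      rw [mul_comm]
      exact mul_le_mul_of_nonneg_left (measureReal_mono (subset_univ _)) (Real.exp_pos _).le
    have hAnn : 0 ≤ ∫ ω in S, Real.exp (t / 2 * (T ω - M)) ∂μ :=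
      setIntegral_nonneg hSm fun ω _ => (Real.exp_pos _).le
    have hBnn : 0 ≤ ∫ ω in Sᶜ, Real.exp (t / 2 * (T ω - M)) ∂μ :=
      setIntegral_nonneg hSm.compl fun ω _ => (Real.exp_pos _).le
    rw [hsplit]
    nlinarith [hA, hB, hAnn, hBnn, mul_nonneg hBnn (Real.exp_pos (-(t * (ε / 2)))).le,
      sq_nonneg (∫ ω in S, Real.exp (t / 2 * (T ω - M)) ∂μ
        - ∫ ω in Sᶜ, Real.exp (t / 2 * (T ω - M)) ∂μ)]
  -- Step D: the tail term tends to `0`; assemble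
  have htail : Tendsto (fun t : ℝ => 2 * μ.real univ ^ 2 / μ.real S' * Real.exp (-(t * (ε / 2))))
      atTop (𝓝 0) := by
    have h := (Real.tendsto_exp_neg_atTop_nhds_zero.comp
      (tendsto_id.atTop_mul_const (half_pos hε0))).const_mul (2 * μ.real univ ^ 2 / μ.real S')
    rw [mul_zero] at h
    exact h
  filter_upwards [eventually_ge_atTop (0 : ℝ),
    Filter.Tendsto.eventually_lt_const (half_pos hδ) htail] with t ht hsmall
  have hΦt : 0 < Φ t := lt_of_lt_of_le (mul_pos (Real.exp_pos _) hS'pos) (hlow t ht)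
  set e : ℝ := Real.exp (-(t * (ε / 2))) with hedef
  have he : 0 < e := Real.exp_pos _
  -- `Φ(t/2)²/Φ(t) ≤ 2 μ(S) + 2 (e μ(Ω))² / Φ(t) ≤ 2 μ(S) + 2 e μ(Ω)² / μ(S')`
  have h1 : Φ (t / 2) ^ 2 / Φ t ≤ 2 * μ.real S + 2 * (e * μ.real univ) ^ 2 / Φ t := by
    rw [div_le_iff₀ hΦt, add_mul, div_mul_cancel₀ _ hΦt.ne']
    exact hup t ht
  have h2 : 2 * (e * μ.real univ) ^ 2 / Φ t ≤ 2 * μ.real univ ^ 2 / μ.real S' * e := by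
    have : 2 * (e * μ.real univ) ^ 2 / Φ t ≤ 2 * (e * μ.real univ) ^ 2 / (e * μ.real S') :=
      div_le_div_of_nonneg_left (by positivity) (mul_pos he hS'pos) (hlow t ht)
    refine this.trans (le_of_eq ?_)
    field_simp
  linarith [h1, h2, hSδ, hsmall]

omit [IsFiniteMeasure μ] in
/-- `Z(t)·e^{−tM} = Φ(t)`: `mgf T μ t · e^{−tM} = ∫ e^{t(T−M)} dμ`. [folklore] -/
theorem mgf_mul_exp_neg_eq (t : ℝ) :
    mgf T μ t * Real.exp (-(t * M)) = ∫ ω, Real.exp (t * (T ω - M)) ∂μ := by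
  rw [mgf, ← integral_mul_const]
  refine integral_congr_ae (ae_of_all _ fun ω => ?_)
  simp only [← Real.exp_add]
  ring_nf

/-- `Z(t/2)²/Z(t) = Φ(t/2)²/Φ(t)` (the factors `e^{−tM}` cancel). [folklore] -/
theorem mgf_half_sq_div_eq [NeZero μ] (hT : Measurable T) (hle : ∀ ω, T ω ≤ M) {t : ℝ}
    (ht : 0 ≤ t) :
    mgf T μ (t / 2) ^ 2 / mgf T μ t = (∫ ω, Real.exp (t / 2 * (T ω - M)) ∂μ) ^ 2
      / ∫ ω, Real.exp (t * (T ω - M)) ∂μ := by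
  rw [← mgf_mul_exp_neg_eq, ← mgf_mul_exp_neg_eq, mul_pow, ← Real.exp_nat_mul]
  have hZ : 0 < mgf T μ t :=
    mgf_pos' (NeZero.ne μ) (integrable_exp_mul_of_le t M ht hT.aemeasurable (ae_of_all _ hle))
  rw [show ((2 : ℕ) : ℝ) * -(t / 2 * M) = -(t * M) by push_cast; ring,
    mul_div_mul_right _ _ (Real.exp_pos _).ne']

/-- **`Z(β/2)²/Z(β) → μ{T = M}` as `β → ∞`** (`Z = mgf T μ`). [ours] -/
theorem tendsto_mgf_half_sq_div [NeZero μ] (hT : Measurable T) (hle : ∀ ω, T ω ≤ M)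
    (hsharp : ∀ ε : ℝ, 0 < ε → 0 < μ {ω | M - ε < T ω}) :
    Tendsto (fun t : ℝ => mgf T μ (t / 2) ^ 2 / mgf T μ t) atTop (𝓝 (μ.real {ω | T ω = M})) := by
  refine (tendsto_sq_integral_exp_half_div hT hle hsharp).congr' ?_
  filter_upwards [eventually_ge_atTop (0 : ℝ)] with t ht
  exact (mgf_half_sq_div_eq hT hle ht).symm

/-- **`Z(β)²/Z(2β) → μ{T = M}` as `β → ∞`** (the ESS ratio; same limit). [ours] -/
theorem tendsto_mgf_sq_div_double [NeZero μ] (hT : Measurable T) (hle : ∀ ω, T ω ≤ M)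
    (hsharp : ∀ ε : ℝ, 0 < ε → 0 < μ {ω | M - ε < T ω}) :
    Tendsto (fun t : ℝ => mgf T μ t ^ 2 / mgf T μ (2 * t)) atTop (𝓝 (μ.real {ω | T ω = M})) := by
  have h := (tendsto_mgf_half_sq_div hT hle hsharp).comp (tendsto_id.const_mul_atTop two_pos)
  refine h.congr fun t => ?_
  simp only [Function.comp_apply, id_eq, mul_div_cancel_left₀ _ (two_ne_zero' ℝ)]

end Tilt

/-! ## §2 U(1) plaquettes: everything tends to `0` -/

section U1

/-- The hypotheses of §1 for `T = cos` on `(0, 2π]`, `M = 1`: `{cos = 1}` is null and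
`{1 − ε < cos}` is charged. [ours] -/
theorem cos_sharp_Ioc :
    (volume.restrict (Ioc (0 : ℝ) (2 * π))).real {θ : ℝ | Real.cos θ = 1} = 0 ∧
    (∀ ε : ℝ, 0 < ε → 0 < (volume.restrict (Ioc (0 : ℝ) (2 * π))) {θ : ℝ | 1 - ε < Real.cos θ}) := by
  constructor
  · rw [measureReal_def, Measure.restrict_apply (measurableSet_eq_fun Real.continuous_cos.measurable
      measurable_const), ENNReal.toReal_eq_zero_iff]
    left
    refine measure_mono_null (fun θ hθ => ?_) (measure_singleton (2 * π))
    obtain ⟨hcos, h0, h2π⟩ : Real.cos θ = 1 ∧ 0 < θ ∧ θ ≤ 2 * π := ⟨hθ.1, hθ.2.1, hθ.2.2⟩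
    obtain ⟨k, hk⟩ := (Real.cos_eq_one_iff θ).1 hcos
    -- `θ = 2πk` with `0 < θ ≤ 2π` forces `k = 1`
    have hk1 : (0 : ℝ) < k := by
      refine lt_of_not_ge fun h => ?_
      have : (k : ℝ) * (2 * π) ≤ 0 := mul_nonpos_of_nonpos_of_nonneg h (by positivity)
      linarith
    have hk2 : (k : ℝ) ≤ 1 := by
      refine le_of_not_gt fun h => ?_
      have : 1 * (2 * π) < (k : ℝ) * (2 * π) := mul_lt_mul_of_pos_right h (by positivity)
      linarith
    have hk' : k = 1 := by
      have h1 : (0 : ℤ) < k := by exact_mod_cast hk1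
      have h2 : k ≤ (1 : ℤ) := by exact_mod_cast hk2
      omega
    rw [Set.mem_singleton_iff, ← hk, hk']
    push_cast; ring
  · intro ε hε
    have hopen : IsOpen {θ : ℝ | 1 - ε < Real.cos θ} := isOpen_lt continuous_const Real.continuous_cos
    have h2π : (2 * π) ∈ {θ : ℝ | 1 - ε < Real.cos θ} := by
      show 1 - ε < Real.cos (2 * π)
      rw [Real.cos_two_pi]; linarith
    obtain ⟨r, hr, hball⟩ := Metric.isOpen_iff.1 hopen (2 * π) h2π
    -- the point `2π − min(r, π)/2` lies in the ball and in the open interval `(0, 2π)`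
    set θ₁ : ℝ := 2 * π - min r π / 2 with hθ₁
    have hmin : 0 < min r π := lt_min hr Real.pi_pos
    have hθ₁ball : θ₁ ∈ Metric.ball (2 * π) r := by
      rw [Metric.mem_ball, Real.dist_eq, hθ₁, show 2 * π - min r π / 2 - 2 * π = -(min r π / 2) by ring,
        abs_neg, abs_of_pos (by positivity)]
      linarith [min_le_left r π]
    have hθ₁I : θ₁ ∈ Ioo (0 : ℝ) (2 * π) := by
      constructor
      · have := min_le_right r π; rw [hθ₁]; linarith [Real.pi_pos]
      · rw [hθ₁]; linarith
    have hW : IsOpen (Ioo (0 : ℝ) (2 * π) ∩ {θ : ℝ | 1 - ε < Real.cos θ}) := isOpen_Ioo.inter hopen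
    have hWpos := hW.measure_pos volume ⟨θ₁, hθ₁I, hball hθ₁ball⟩
    rw [Measure.restrict_apply (measurableSet_lt measurable_const Real.continuous_cos.measurable)]
    refine lt_of_lt_of_le hWpos (measure_mono fun θ hθ => ⟨hθ.2, Ioo_subset_Ioc_self hθ.1⟩)

/-- `Z(β) = 2π I₀(β)` is the moment generating function of `cos` on `(0, 2π]`. [folklore] -/
theorem besselI_zero_eq_mgf (β : ℝ) :
    2 * π * besselI 0 β = mgf (fun θ => Real.cos θ) (volume.restrict (Ioc (0 : ℝ) (2 * π))) β := by
  rw [← onePlaquetteZ_eq_besselI, ← integral_Ioc_exp_mul_cos]; rfl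

/-- **`I₀(β/2)²/I₀(β) → 0` as `β → ∞`** (the per-plaquette Bhattacharyya ceiling of the untrained
U(1) sampler vanishes at weak coupling). [ours] -/
theorem tendsto_besselI_half_sq_div_atTop :
    Tendsto (fun β : ℝ => besselI 0 (β / 2) ^ 2 / besselI 0 β) atTop (𝓝 0) := by
  haveI : NeZero (volume.restrict (Ioc (0 : ℝ) (2 * π))) := ⟨by
    rw [Ne, Measure.restrict_eq_zero, Real.volume_Ioc]
    exact (ENNReal.ofReal_pos.2 (by linarith [Real.pi_pos])).ne'⟩
  obtain ⟨hnull, hsharp⟩ := cos_sharp_Ioc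
  have h := tendsto_mgf_half_sq_div (μ := volume.restrict (Ioc (0 : ℝ) (2 * π)))
    (T := fun θ => Real.cos θ) (M := 1) Real.continuous_cos.measurable Real.cos_le_one hsharp
  rw [hnull] at h
  have e : ∀ β : ℝ, besselI 0 (β / 2) ^ 2 / besselI 0 β = (1 / (2 * π)) *
      (mgf (fun θ => Real.cos θ) (volume.restrict (Ioc (0 : ℝ) (2 * π))) (β / 2) ^ 2
        / mgf (fun θ => Real.cos θ) (volume.restrict (Ioc (0 : ℝ) (2 * π))) β) := fun β => by
    rw [← besselI_zero_eq_mgf, ← besselI_zero_eq_mgf]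
    have hI : 0 < besselI 0 β := besselI_zero_pos β
    field_simp
  simp_rw [e]
  simpa using h.const_mul (1 / (2 * π))

/-- **`I₀(β)²/I₀(2β) → 0` as `β → ∞`** (the per-plaquette ESS of the untrained U(1) sampler
vanishes at weak coupling). [ours] -/
theorem tendsto_besselI_sq_div_double_atTop :
    Tendsto (fun β : ℝ => besselI 0 β ^ 2 / besselI 0 (2 * β)) atTop (𝓝 0) := by
  have h := tendsto_besselI_half_sq_div_atTop.comp (tendsto_id.const_mul_atTop two_pos)
  refine h.congr fun β => ?_
  simp only [Function.comp_apply, id_eq, mul_div_cancel_left₀ _ (two_ne_zero' ℝ)]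

variable {ι : Type*} [Fintype ι] [Nonempty ι]

/-- **THE UNTRAINED U(1) SAMPLER'S EXACT ESS TENDS TO `0` AT WEAK COUPLING**: for `V = card ι ≥ 1`
independent plaquettes, row 3's `u1IdentityFlow_essFrac` (`= (I₀(β)²/I₀(2β))^V`) `→ 0` as `β → ∞`.
[ours] -/
theorem u1IdentityFlow_essFrac_weakCoupling_tendsto_zero :
    Tendsto (fun β : ℝ =>
      (∫ x, ∏ i : ι, Real.exp (β * Real.cos (x i)) / onePlaquetteZ β
          ∂(Measure.pi fun _ : ι => volume.restrict (Ioc (0 : ℝ) (2 * π)))) ^ 2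
        / ∫ x, (∏ i : ι, Real.exp (β * Real.cos (x i)) / onePlaquetteZ β) ^ 2
            / ∏ _i : ι, (1 / (2 * π) : ℝ)
          ∂(Measure.pi fun _ : ι => volume.restrict (Ioc (0 : ℝ) (2 * π)))) atTop (𝓝 0) := by
  simp_rw [u1IdentityFlow_essFrac (ι := ι)]
  have h := tendsto_besselI_sq_div_double_atTop.pow (Fintype.card ι)
  rwa [zero_pow Fintype.card_ne_zero] at h

/-- **THE UNTRAINED U(1) SAMPLER'S ACCEPTANCE TENDS TO `0` AT WEAK COUPLING** (every `V ≥ 1`;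
squeezed between `0` and the ceiling `(I₀(β/2)²/I₀(β))^V` of `u1IdentityFlow_meanAccept_mem_Icc`).
[ours] -/
theorem u1IdentityFlow_meanAccept_weakCoupling_tendsto_zero :
    Tendsto (fun β : ℝ => ∫ x, ∫ x', min
        ((∏ i : ι, Real.exp (β * Real.cos (x i)) / onePlaquetteZ β) * ∏ _i : ι, (1 / (2 * π) : ℝ))
        ((∏ i : ι, Real.exp (β * Real.cos (x' i)) / onePlaquetteZ β) * ∏ _i : ι, (1 / (2 * π) : ℝ))
        ∂(Measure.pi fun _ : ι => volume.restrict (Ioc (0 : ℝ) (2 * π)))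
        ∂(Measure.pi fun _ : ι => volume.restrict (Ioc (0 : ℝ) (2 * π)))) atTop (𝓝 0) := by
  have hceil : Tendsto (fun β : ℝ => (besselI 0 (β / 2) ^ 2 / besselI 0 β) ^ Fintype.card ι)
      atTop (𝓝 0) := by
    have h := tendsto_besselI_half_sq_div_atTop.pow (Fintype.card ι)
    rwa [zero_pow Fintype.card_ne_zero] at h
  refine tendsto_of_tendsto_of_tendsto_of_le_of_le tendsto_const_nhds hceil (fun β => ?_) fun β => ?_
  · have h := (u1IdentityFlow_meanAccept_mem_Icc (ι := ι) β).1
    exact le_trans (mul_nonneg (by norm_num) (pow_nonneg (div_nonneg (sq_nonneg _)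
      (besselI_zero_pos _).le) _)) h
  · exact (u1IdentityFlow_meanAccept_mem_Icc (ι := ι) β).2

end U1

end Summit.Ventures.LatticeQCDFlow.Theory2

end
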